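import Literature.NumberTheory.Sieve.SmoothMinorArcsSup
import Literature.NumberTheory.Sieve.SmoothSaddlePointPhi
import HarnessLib

/-!
# Minor arcs for the smooth-weighted exponential sums over smooth numbers

Topic `Literature/NumberTheory/Sieve`; a PROVED file toward
`Literature.NumberTheory.DiophantineGeometry.XYZUpperHalf` ([Harper2016, Cor. 1], §5 with the
smooth weight `w(v) = v²(1−v)²`). For `X ≤ x` put
`S_w(θ; X) = ∑_{n ∈ S(X, y)} w(n/X) e(nθ)`. By Abel summation from the sharp sums
`U_n(θ) = ∑_{m ∈ S(n, y)} e(mθ)` (with `|w((n+1)/X) − w(n/X)| ≤ 2(n+1)/X²`) and the tree's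
minor-arc bound `norm_smoothExpSum_le_of_minor` at every scale `x/R ≤ n ≤ X` (with the parameter
`R n/x`, the scale-`n` saddle data being dominated by the scale-`x` data through
`rpow_mul_smoothZeta_saddlePoint_le`, `saddlePoint_antitone` and the two-sided bounds for `φ₂`):

`norm_smoothWeightSum_le_of_minor`: for `x ≥ x₀` in the polylogarithmic range, `x/2 ≤ X ≤ x`,
`1 ≤ R ≤ x^{1/10}` and `θ` with `|θ − a/q| > R/x` for all `q ≤ R`:
`‖S_w(θ; X)‖ ≤ C (log x)³ y^{5/2(1−α)} R^{−1/2+3/2(1−α)} 𝓟 + 164 (1 + log x)² y² x^{9/10} + 64 x/R³ + 1`,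
`𝓟 = x^α ζ(α,y)/√φ₂(α,y)`, `α = α(x,y)`.

## References

* A. J. Harper, Compositio Math. 152 (2016), Theorem 1 and §5 [Harper2016].
-/

noncomputable section

open Finset Real Complex
open scoped FourierTransform

namespace Literature.NumberTheory.Sieve

namespace Endgame

/-! ### The smooth weight and its variation -/

/-- `w(v) = v²(1−v)²`. [cite: Harper2016, §5] -/
def wt (v : ℝ) : ℝ := v ^ 2 * (1 - v) ^ 2

/-- `0 ≤ w`. [folklore] -/
theorem wt_nonneg (v : ℝ) : 0 ≤ wt v := by unfold wt; positivity

/-- `w ≤ 1` on `[0, 1]`. [folklore] -/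
theorem wt_le_one {v : ℝ} (hv0 : 0 ≤ v) (hv1 : v ≤ 1) : wt v ≤ 1 := by
  unfold wt
  have h1 : v ^ 2 ≤ 1 := by nlinarith
  have h2 : (1 - v) ^ 2 ≤ 1 := by nlinarith
  nlinarith [sq_nonneg v, sq_nonneg (1 - v)]

/-- `w(v) ≤ 4(1 − v)²` for `|v| ≤ 2`. [folklore] -/
theorem wt_le_sq_sub (v : ℝ) (hv : |v| ≤ 2) : wt v ≤ 4 * (1 - v) ^ 2 := by
  unfold wt
  have : v ^ 2 ≤ 4 := by nlinarith [abs_le.mp hv]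
  nlinarith [sq_nonneg (1 - v)]

/-- `w` has derivative `2t(1−t)² − 2t²(1−t)`. [folklore] -/
theorem hasDerivAt_wt (t : ℝ) : HasDerivAt wt (2 * t * (1 - t) ^ 2 - 2 * t ^ 2 * (1 - t)) t := by
  have h : HasDerivAt (fun t : ℝ => t ^ 2 * (1 - t) ^ 2) (2 * t * (1 - t) ^ 2 - 2 * t ^ 2 * (1 - t)) t := by
    have h1 : HasDerivAt (fun t : ℝ => t ^ 2) (2 * t) t := by simpa using hasDerivAt_pow 2 t
    have h2 : HasDerivAt (fun t : ℝ => (1 - t) ^ 2) (2 * (1 - t) * (-1)) t := by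
      have h3 : HasDerivAt (fun w : ℝ => (1 - w) * (1 - w)) (-1 * (1 - t) + (1 - t) * -1) t :=
        ((hasDerivAt_id t).const_sub 1).fun_mul ((hasDerivAt_id t).const_sub 1)
      have h4 : (fun w : ℝ => (1 - w) ^ 2) = fun w : ℝ => (1 - w) * (1 - w) := by funext w; ring
      rw [h4, show 2 * (1 - t) * (-1 : ℝ) = -1 * (1 - t) + (1 - t) * -1 by ring]
      exact h3
    have h5 := h1.fun_mul h2
    exact h5.congr_deriv (by ring)
  exact h

/-- `|w(u) − w(v)| ≤ 2u (u − v)` for `0 ≤ v ≤ u ≤ 1` (`|w'(t)| = 2t(1−t)|1−2t| ≤ 2t ≤ 2u`). [folklore] -/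
theorem abs_wt_sub_le {u v : ℝ} (hu1 : u ≤ 1) (hv0 : 0 ≤ v) (hvu : v ≤ u) :
    |wt u - wt v| ≤ 2 * u * (u - v) := by
  have hderiv : ∀ t ∈ Set.Icc v u, DifferentiableAt ℝ wt t := fun t _ => (hasDerivAt_wt t).differentiableAt
  have hbound : ∀ t ∈ Set.Icc v u, ‖deriv wt t‖ ≤ 2 * u := by
    intro t ht
    rw [(hasDerivAt_wt t).deriv, Real.norm_eq_abs]
    have ht0 : 0 ≤ t := hv0.trans ht.1
    have ht1 : t ≤ 1 := ht.2.trans hu1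
    rw [show 2 * t * (1 - t) ^ 2 - 2 * t ^ 2 * (1 - t) = 2 * t * (1 - t) * (1 - 2 * t) by ring, abs_mul, abs_mul,
      abs_of_nonneg (by linarith : (0:ℝ) ≤ 2 * t), abs_of_nonneg (by linarith : (0:ℝ) ≤ 1 - t)]
    have h12 : |1 - 2 * t| ≤ 1 := by rw [abs_le]; constructor <;> linarith
    calc 2 * t * (1 - t) * |1 - 2 * t| ≤ 2 * t * 1 * 1 := by
          apply mul_le_mul (mul_le_mul_of_nonneg_left (by linarith) (by linarith)) h12 (abs_nonneg _) (by positivity)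
      _ ≤ 2 * u := by linarith [ht.2]
  have h := (convex_Icc v u).norm_image_sub_le_of_norm_deriv_le hderiv hbound
    (Set.left_mem_Icc.mpr hvu) (Set.right_mem_Icc.mpr hvu)
  rw [Real.norm_eq_abs, Real.norm_eq_abs, abs_of_nonneg (by linarith : (0:ℝ) ≤ u - v)] at h
  exact h

/-- The smooth-weighted sum `S_w(θ; X) = ∑_{n ∈ S(X,y)} w(n/X) e(nθ)`. [cite: Harper2016, §5] -/
def smoothWeightSum (X : ℝ) (y : ℕ) (θ : ℝ) : ℂ :=
  ∑ n ∈ Nat.smoothNumbersUpTo ⌊X⌋₊ (y + 1), (wt (n / X) : ℂ) * (𝐞 ((n : ℝ) * θ) : ℂ)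

/-- The sharp sum at scale `n`: `U_n(θ) = ∑_{m ∈ S(n,y)} e(mθ)`. [cite: Harper2016, Theorem 1] -/
def sharpSum (n y : ℕ) (θ : ℝ) : ℂ :=
  ∑ m ∈ Nat.smoothNumbersUpTo n (y + 1), (𝐞 ((m : ℝ) * θ) : ℂ)

/-- `‖U_n(θ)‖ ≤ n`. [folklore] -/
theorem norm_sharpSum_le (n y : ℕ) (θ : ℝ) : ‖sharpSum n y θ‖ ≤ n := by
  unfold sharpSum
  calc _ ≤ ∑ m ∈ Nat.smoothNumbersUpTo n (y + 1), ‖(𝐞 ((m : ℝ) * θ) : ℂ)‖ := norm_sum_le _ _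
    _ = (Nat.smoothNumbersUpTo n (y + 1)).card := by simp
    _ ≤ n := by
        have : Nat.smoothNumbersUpTo n (y + 1) ⊆ Finset.Icc 1 n := by
          intro m hm
          rw [Nat.mem_smoothNumbersUpTo] at hm
          exact Finset.mem_Icc.mpr ⟨Nat.pos_of_ne_zero (Nat.ne_zero_of_mem_smoothNumbers hm.2), hm.1⟩
        have h := Finset.card_le_card this
        rw [Nat.card_Icc] at h
        exact_mod_cast (by omega : (Nat.smoothNumbersUpTo n (y + 1)).card ≤ n)

/-! ### Abel summation from the sharp sums -/

/-- `S_w(θ; X) = ∑_{n=1}^{N} c_n (U_n − U_{n−1})`, `c_n = w(n/X)`, `N = ⌊X⌋`, summed by parts: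
`‖S_w(θ;X)‖ ≤ |c_N| ‖U_N‖ + ∑_{n=1}^{N−1} |c_{n+1} − c_n| ‖U_n‖`. [folklore] -/
theorem norm_smoothWeightSum_le_abel (X : ℝ) (y : ℕ) (θ : ℝ) :
    ‖smoothWeightSum X y θ‖ ≤ |wt (⌊X⌋₊ / X)| * ‖sharpSum ⌊X⌋₊ y θ‖ +
      ∑ n ∈ Ico 1 ⌊X⌋₊, |wt ((n + 1 : ℕ) / X) - wt (n / X)| * ‖sharpSum n y θ‖ := by
  classical
  set N : ℕ := ⌊X⌋₊ with hN
  set c : ℕ → ℝ := fun n => wt (n / X) with hc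
  set u : ℕ → ℂ := fun n => if n ∈ Nat.smoothNumbers (y + 1) then (𝐞 ((n : ℝ) * θ) : ℂ) else 0 with hu
  -- `U_n = ∑_{m=1}^{n} u_m = ∑_{j<n} u_{j+1}`
  have hU : ∀ n : ℕ, sharpSum n y θ = ∑ j ∈ range n, u (j + 1) := by
    intro n
    rw [sharpSum]
    have h1 : ∑ j ∈ range n, u (j + 1) = ∑ m ∈ Icc 1 n, u m := by
      refine Finset.sum_nbij' (fun j => j + 1) (fun m => m - 1) ?_ ?_ ?_ ?_ ?_
      · intro j hj; have := Finset.mem_range.mp hj; exact Finset.mem_Icc.mpr ⟨by omega, by omega⟩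
      · intro m hm; have := Finset.mem_Icc.mp hm; exact Finset.mem_range.mpr (by omega)
      · intro j _; omega
      · intro m hm; have := Finset.mem_Icc.mp hm; omega
      · intro j _; rfl
    rw [h1, hu]
    rw [Finset.sum_ite, Finset.sum_const_zero, add_zero]
    congr 1
    ext m
    simp only [Finset.mem_filter, Finset.mem_Icc, Nat.mem_smoothNumbersUpTo]
    constructor
    · rintro ⟨hmn, hmS⟩; exact ⟨⟨Nat.pos_of_ne_zero (Nat.ne_zero_of_mem_smoothNumbers hmS), hmn⟩, hmS⟩
    · rintro ⟨⟨-, hmn⟩, hmS⟩; exact ⟨hmn, hmS⟩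
  -- `S_w = ∑_{i<N} c_{i+1} u_{i+1}`
  have hS : smoothWeightSum X y θ = ∑ i ∈ range N, (c (i + 1) : ℂ) • u (i + 1) := by
    rw [smoothWeightSum]
    have h1 : ∑ i ∈ range N, (c (i + 1) : ℂ) • u (i + 1) = ∑ n ∈ Icc 1 N, (c n : ℂ) * u n := by
      refine Finset.sum_nbij' (fun j => j + 1) (fun m => m - 1) ?_ ?_ ?_ ?_ ?_
      · intro j hj; have := Finset.mem_range.mp hj; exact Finset.mem_Icc.mpr ⟨by omega, by omega⟩
      · intro m hm; have := Finset.mem_Icc.mp hm; exact Finset.mem_range.mpr (by omega)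
      · intro j _; omega
      · intro m hm; have := Finset.mem_Icc.mp hm; omega
      · intro j _; rw [smul_eq_mul]
    rw [h1, hu]
    simp_rw [mul_ite, mul_zero]
    rw [Finset.sum_ite, Finset.sum_const_zero, add_zero]
    refine Finset.sum_congr ?_ fun n _ => rfl
    ext m
    simp only [Finset.mem_filter, Finset.mem_Icc, Nat.mem_smoothNumbersUpTo, hN]
    constructor
    · rintro ⟨hmn, hmS⟩; exact ⟨⟨Nat.pos_of_ne_zero (Nat.ne_zero_of_mem_smoothNumbers hmS), hmn⟩, hmS⟩
    · rintro ⟨⟨-, hmn⟩, hmS⟩; exact ⟨hmn, hmS⟩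
  rw [hS, Finset.sum_range_by_parts]
  simp_rw [← hU]
  rcases Nat.eq_zero_or_pos N with hN0 | hNpos
  · have h0 : sharpSum 0 y θ = 0 := by
      unfold sharpSum
      refine Finset.sum_eq_zero fun m hm => ?_
      rw [Nat.mem_smoothNumbersUpTo] at hm
      exact absurd (Nat.ne_zero_of_mem_smoothNumbers hm.2) (by omega)
    simp [hN0, h0]
  rw [Nat.sub_add_cancel hNpos]
  calc ‖(c N : ℂ) • sharpSum N y θ - ∑ i ∈ range (N - 1), ((c (i + 1 + 1) : ℂ) - c (i + 1)) • sharpSum (i + 1) y θ‖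
      ≤ ‖(c N : ℂ) • sharpSum N y θ‖ + ‖∑ i ∈ range (N - 1), ((c (i + 1 + 1) : ℂ) - c (i + 1)) • sharpSum (i + 1) y θ‖ :=
        norm_sub_le _ _
    _ ≤ |c N| * ‖sharpSum N y θ‖ + ∑ i ∈ range (N - 1), |c (i + 1 + 1) - c (i + 1)| * ‖sharpSum (i + 1) y θ‖ := by
        apply add_le_add
        · rw [norm_smul, Complex.norm_real, Real.norm_eq_abs]
        · refine (norm_sum_le _ _).trans (Finset.sum_le_sum fun i _ => ?_)
          rw [norm_smul, ← Complex.ofReal_sub, Complex.norm_real, Real.norm_eq_abs]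
    _ = |wt (⌊X⌋₊ / X)| * ‖sharpSum ⌊X⌋₊ y θ‖ + ∑ n ∈ Ico 1 ⌊X⌋₊, |wt ((n + 1 : ℕ) / X) - wt (n / X)| * ‖sharpSum n y θ‖ := by
        congr 1
        refine Finset.sum_nbij' (fun i => i + 1) (fun n => n - 1) ?_ ?_ ?_ ?_ ?_
        · intro i hi; have := Finset.mem_range.mp hi; exact Finset.mem_Ico.mpr ⟨by omega, by omega⟩
        · intro n hn; have := Finset.mem_Ico.mp hn; exact Finset.mem_range.mpr (by omega)
        · intro i _; omega
        · intro n hn; have := Finset.mem_Ico.mp hn; omega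
        · intro i _; simp [hc]

/-! ### The sharp sums at the scales `x/R ≤ n ≤ x` on a minor arc -/

set_option maxHeartbeats 1600000 in
/-- **The sharp sums at sub-scales.** In the range `x ≥ x₀`, `(log x)^8 ≤ y`,
`log y ≤ ½ (log x)^{1/6}`, `y^{80} ≤ x`, `1 ≤ R ≤ x^{1/10}`, for every natural `n` with
`x/R ≤ n ≤ x` and every `θ` with `|θ − a/q| > R/x` for all `1 ≤ q ≤ R`:
`‖U_n(θ)‖ ≤ C (log x)³ y^{5/2(1−α)} R^{−1/2+3/2(1−α)} 𝓟 + 41 (1 + log x)² y² x^{9/10}` with the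
scale-`x` data `α = α(x,y)`, `𝓟 = x^α ζ(α,y)/√φ₂(α,y)`. [cite: Harper2016, Theorem 1] -/
theorem norm_sharpSum_le_of_minor :
    ∃ C x₀ : ℝ, 0 < C ∧ ∀ (x : ℝ) (y : ℕ), x₀ ≤ x → Real.log x ^ 8 ≤ y →
      Real.log y ≤ 1 / 2 * Real.log x ^ (1 / 6 : ℝ) → (y : ℝ) ^ 80 ≤ x → ∀ (R : ℝ), 1 ≤ R → R ≤ x ^ (1 / 10 : ℝ) →
      ∀ θ : ℝ, (∀ q : ℕ, 1 ≤ q → (q : ℝ) ≤ R → ∀ a : ℤ, R / x < |θ - a / q|) →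
      ∀ n : ℕ, x / R ≤ n → (n : ℝ) ≤ x →
        ‖sharpSum n y θ‖ ≤
          C * Real.log x ^ 3 * (y : ℝ) ^ (5 / 2 * (1 - saddlePoint x y)) *
            R ^ (-(1 / 2 : ℝ) + 3 / 2 * (1 - saddlePoint x y)) *
            (x ^ saddlePoint x y * (smoothZeta (saddlePoint x y) y / Real.sqrt (saddlePhi₂ (saddlePoint x y) y))) +
          41 * (1 + Real.log x) ^ 2 * (y : ℝ) ^ 2 * x ^ (9 / 10 : ℝ) := by
  classical
  obtain ⟨C, x₀m, hC, hmin⟩ := norm_smoothExpSum_le_of_minor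
  obtain ⟨c_φ, x_φ, hc_φ, hφlo⟩ := le_saddlePhi₂_saddlePoint
  obtain ⟨x_φ', hφhi⟩ := saddlePhi₂_saddlePoint_le
  obtain ⟨x₁, hlt1⟩ := saddlePoint_lt_one
  set K : ℝ := Real.sqrt (3 / (9 / 10 * c_φ)) with hK
  have hK0 : 0 < K := Real.sqrt_pos.mpr (by positivity)
  -- thresholds: all the scale-`n` hypotheses need `n ≥ x^{9/10} ≥ …`
  set X₀ : ℝ := max (max (max x₀m x_φ) (max x_φ' x₁)) (Real.exp 100) with hX₀
  refine ⟨C * K, X₀ ^ (2 : ℕ), by positivity, fun x y hx hy8 hylog hy80 R hR1 hRx θ hminor n hnlo hnx => ?_⟩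
  -- ### basic facts about `x`
  have hX₀1 : 1 ≤ X₀ := le_trans (by have := Real.one_lt_exp_iff.mpr (by norm_num : (0:ℝ) < 100); linarith) (le_max_right _ _)
  have hxX₀ : X₀ ≤ x := le_trans (by nlinarith) hx
  have hxexp : Real.exp 100 ≤ x := le_trans (le_max_right _ _) hxX₀
  have hx1 : 1 < x := lt_of_lt_of_le (by have := Real.one_lt_exp_iff.mpr (by norm_num : (0:ℝ) < 100); linarith) hxexp
  have hx0 : 0 < x := by linarith
  have hlogx : 100 ≤ Real.log x := by
    have := Real.log_le_log (Real.exp_pos _) hxexp; rwa [Real.log_exp] at this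
  have hlogx0 : 0 < Real.log x := by linarith
  -- `n ≥ x/R ≥ x^{9/10} ≥ √x ≥ X₀`
  have hxR : x ^ (9 / 10 : ℝ) ≤ x / R := by
    rw [le_div_iff₀ (by linarith)]
    calc x ^ (9 / 10 : ℝ) * R ≤ x ^ (9 / 10 : ℝ) * x ^ (1 / 10 : ℝ) := mul_le_mul_of_nonneg_left hRx (by positivity)
      _ = x := by rw [← Real.rpow_add hx0]; norm_num
  have hn910 : x ^ (9 / 10 : ℝ) ≤ n := hxR.trans hnlo
  have hsqrt_le : X₀ ≤ x ^ (1 / 2 : ℝ) := by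
    have : (X₀ ^ (2 : ℕ)) ^ (1 / 2 : ℝ) ≤ x ^ (1 / 2 : ℝ) := Real.rpow_le_rpow (by positivity) hx (by norm_num)
    rwa [← Real.rpow_natCast, ← Real.rpow_mul (by positivity), show ((2 : ℕ) : ℝ) * (1 / 2) = 1 by norm_num,
      Real.rpow_one] at this
  have hx12_le : x ^ (1 / 2 : ℝ) ≤ x ^ (9 / 10 : ℝ) := Real.rpow_le_rpow_of_exponent_le hx1.le (by norm_num)
  have hnX₀ : X₀ ≤ n := hsqrt_le.trans (hx12_le.trans hn910)
  have hn1 : (1 : ℝ) < n := by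
    have : Real.exp 100 ≤ (n : ℝ) := le_trans (le_max_right _ _) hnX₀
    have := Real.one_lt_exp_iff.mpr (by norm_num : (0:ℝ) < 100); linarith
  have hn0 : (0 : ℝ) < n := by linarith
  have hlogn : 9 / 10 * Real.log x ≤ Real.log n := by
    have := Real.log_le_log (by positivity) hn910
    rwa [Real.log_rpow hx0] at this
  have hlognx : Real.log n ≤ Real.log x := Real.log_le_log hn0 hnx
  have hlogn0 : 0 < Real.log n := by linarith
  -- `y`
  have hy2r : (2 : ℝ) ≤ y := by
    have : (100 : ℝ) ^ 8 ≤ Real.log x ^ 8 := pow_le_pow_left₀ (by norm_num) hlogx 8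
    linarith
  have hy2 : 2 ≤ y := by exact_mod_cast hy2r
  have hy1 : (1 : ℝ) ≤ y := by linarith
  have hyx : (y : ℝ) ≤ x := by
    calc (y : ℝ) = (y : ℝ) ^ (1 : ℕ) := (pow_one _).symm
      _ ≤ (y : ℝ) ^ (80 : ℕ) := pow_le_pow_right₀ hy1 (by norm_num)
      _ ≤ x := by exact_mod_cast hy80
  have hyn : (y : ℝ) ≤ n := by
    -- `y ≤ y^{40} ≤ x^{1/2} ≤ n`
    have h1 : (y : ℝ) ^ (80 : ℕ) ≤ x := hy80
    have h2 : ((y : ℝ) ^ (80 : ℕ)) ^ (1 / 2 : ℝ) ≤ x ^ (1 / 2 : ℝ) := Real.rpow_le_rpow (by positivity) h1 (by norm_num)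
    rw [← Real.rpow_natCast, ← Real.rpow_mul (by positivity), show ((80 : ℕ) : ℝ) * (1 / 2) = ((40 : ℕ) : ℝ) by norm_num,
      Real.rpow_natCast] at h2
    calc (y : ℝ) = (y : ℝ) ^ (1 : ℕ) := (pow_one _).symm
      _ ≤ (y : ℝ) ^ (40 : ℕ) := pow_le_pow_right₀ hy1 (by norm_num)
      _ ≤ x ^ (1 / 2 : ℝ) := h2
      _ ≤ n := hx12_le.trans hn910
  have hy40n : (y : ℝ) ^ 40 ≤ n := by
    have h2 : ((y : ℝ) ^ (80 : ℕ)) ^ (1 / 2 : ℝ) ≤ x ^ (1 / 2 : ℝ) := Real.rpow_le_rpow (by positivity) hy80 (by norm_num)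
    rw [← Real.rpow_natCast, ← Real.rpow_mul (by positivity), show ((80 : ℕ) : ℝ) * (1 / 2) = ((40 : ℕ) : ℝ) by norm_num,
      Real.rpow_natCast] at h2
    exact h2.trans (hx12_le.trans hn910)
  have hlog3y : Real.log x ^ 3 ≤ y := by
    have : Real.log x ^ 3 ≤ Real.log x ^ 8 := pow_le_pow_right₀ (by linarith) (by norm_num)
    linarith
  have hlog3yn : Real.log n ^ 3 ≤ y := le_trans (pow_le_pow_left₀ hlogn0.le hlognx 3) hlog3y
  have hlog8yn : Real.log n ^ 8 ≤ y := le_trans (pow_le_pow_left₀ hlogn0.le hlognx 8) hy8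
  have hylogn : Real.log y ≤ Real.log n ^ (1 / 6 : ℝ) := by
    -- `(log n)^{1/6} ≥ (0.9 log x)^{1/6} ≥ (1/2) (log x)^{1/6} · 2 ≥ …`: we use `(9/10)^{1/6} ≥ 1/2`
    have h1 : (9 / 10 * Real.log x) ^ (1 / 6 : ℝ) ≤ Real.log n ^ (1 / 6 : ℝ) :=
      Real.rpow_le_rpow (by positivity) hlogn (by norm_num)
    have h2 : (9 / 10 * Real.log x) ^ (1 / 6 : ℝ) = (9 / 10 : ℝ) ^ (1 / 6 : ℝ) * Real.log x ^ (1 / 6 : ℝ) :=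
      Real.mul_rpow (by norm_num) hlogx0.le
    have h3 : (1 / 2 : ℝ) ≤ (9 / 10 : ℝ) ^ (1 / 6 : ℝ) := by
      have : (1 / 2 : ℝ) = ((1 / 2 : ℝ) ^ (6 : ℕ)) ^ (1 / 6 : ℝ) := by
        rw [← Real.rpow_natCast, ← Real.rpow_mul (by norm_num)]; norm_num
      rw [this]
      exact Real.rpow_le_rpow (by norm_num) (by norm_num) (by norm_num)
    have h4 : 0 ≤ Real.log x ^ (1 / 6 : ℝ) := by positivity
    nlinarith [h1, h2, h3, h4, hylog]
  have hyloglx : Real.log y ≤ Real.log x ^ (1 / 6 : ℝ) := by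
    have h4 : 0 ≤ Real.log x ^ (1 / 6 : ℝ) := by positivity
    linarith
  -- `R_n = R n / x ∈ [1, R]`, `R_n ≤ n^{1/5}`
  set Rn : ℝ := R * n / x with hRn
  have hRn1 : 1 ≤ Rn := by
    rw [hRn, le_div_iff₀ hx0, one_mul]
    rw [div_le_iff₀ (by linarith)] at hnlo; linarith
  have hRnR : Rn ≤ R := by
    rw [hRn, div_le_iff₀ hx0]; nlinarith
  have hRn5 : Rn ≤ (n : ℝ) ^ (1 / 5 : ℝ) := by
    -- `R_n ≤ R ≤ x^{1/10} ≤ (x^{9/10})^{1/5} ≤ n^{1/5}` (as `1/10 ≤ 9/50`)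
    have h1 : x ^ (1 / 10 : ℝ) ≤ (x ^ (9 / 10 : ℝ)) ^ (1 / 5 : ℝ) := by
      rw [← Real.rpow_mul hx0.le]
      exact Real.rpow_le_rpow_of_exponent_le hx1.le (by norm_num)
    have h2 : (x ^ (9 / 10 : ℝ)) ^ (1 / 5 : ℝ) ≤ (n : ℝ) ^ (1 / 5 : ℝ) := Real.rpow_le_rpow (by positivity) hn910 (by norm_num)
    linarith
  -- the minor condition at scale `n` with parameter `R_n`
  have hminor_n : ∀ q : ℕ, 1 ≤ q → (q : ℝ) ≤ Rn → ∀ a : ℤ, Rn / n < |θ - a / q| := by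
    intro q hq hqR a
    have h1 := hminor q hq (hqR.trans hRnR) a
    have h2 : Rn / n = R / x := by rw [hRn]; field_simp
    rwa [h2]
  -- ### apply the sharp minor-arc bound at scale `n`
  have hmain := hmin n y (le_trans (le_trans (le_trans (le_max_left _ _) (le_max_left _ _)) (le_max_left _ _)) hnX₀)
    hlog8yn hylogn hy40n Rn hRn1 hRn5 θ hminor_n
  rw [Nat.floor_natCast] at hmain
  rw [show (∑ m ∈ Nat.smoothNumbersUpTo n (y + 1), (𝐞 ((m : ℝ) * θ) : ℂ)) = sharpSum n y θ from rfl] at hmain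
  refine hmain.trans ?_
  -- ### dominate the scale-`n` data by the scale-`x` data
  set α : ℝ := saddlePoint x y with hαdef
  set αn : ℝ := saddlePoint n y with hαndef
  have hα0 : 0 < α := saddlePoint_pos hx1 hy2
  have hαn0 : 0 < αn := saddlePoint_pos hn1 hy2
  have hααn : α ≤ αn := saddlePoint_antitone hn1 hnx hy2
  have hx₁n : x₁ ≤ n := le_trans (le_trans (le_trans (le_max_right _ _) (le_max_right _ _)) (le_max_left _ _)) hnX₀
  have hαn1 : αn < 1 := hlt1 n y hx₁n hlog3yn hyn hylogn
  have hα1 : α < 1 := lt_of_le_of_lt hααn hαn1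
  -- (a) `log n ≤ log x`
  have hlog3 : Real.log n ^ 3 ≤ Real.log x ^ 3 := pow_le_pow_left₀ hlogn0.le hlognx 3
  -- (b) `y^{5/2(1−αn)} ≤ y^{5/2(1−α)}`
  have hyexp : (y : ℝ) ^ (5 / 2 * (1 - αn)) ≤ (y : ℝ) ^ (5 / 2 * (1 - α)) :=
    Real.rpow_le_rpow_of_exponent_le hy1 (by nlinarith)
  -- (c) `R_n^{−1/2+3/2(1−αn)} ≤ R_n^{−1/2+3/2(1−α)} = R^{e} (n/x)^{e} ≤ R^{e} (n/x)^{-α} …`: we show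
  --     `R_n^{e_n} · n^{αn} ζ(αn)/√φ₂(αn) ≤ K R^{e} x^α ζ(α)/√φ₂(α)`
  have heexp : Rn ^ (-(1 / 2 : ℝ) + 3 / 2 * (1 - αn)) ≤ Rn ^ (-(1 / 2 : ℝ) + 3 / 2 * (1 - α)) :=
    Real.rpow_le_rpow_of_exponent_le hRn1 (by nlinarith)
  -- (d) minimality at scale `n`: `n^{αn} ζ(αn, y) ≤ n^{α} ζ(α, y)`
  have hminim : (n : ℝ) ^ αn * smoothZeta αn y ≤ (n : ℝ) ^ α * smoothZeta α y := rpow_mul_smoothZeta_saddlePoint_le hn1 hy2 hα0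
  -- (e) `φ₂(α, y) ≤ 3 log x log y ≤ (3/(0.9 c_φ)) φ₂(αn, y)`
  have hφn : c_φ * (Real.log n * Real.log y) ≤ saddlePhi₂ αn y :=
    hφlo n y (le_trans (le_trans (le_trans (le_max_right _ _) (le_max_left _ _)) (le_max_left _ _)) hnX₀) hlog3yn hyn
  have hφx : saddlePhi₂ α y ≤ 3 * Real.log x * Real.log y :=
    hφhi x y (le_trans (le_trans (le_trans (le_max_left _ _) (le_max_right _ _)) (le_max_left _ _)) hxX₀) hlog3y hyx
  have hlogy0 : 0 < Real.log y := Real.log_pos (by linarith)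
  have hφn0 : 0 < saddlePhi₂ αn y := saddlePhi₂_pos hy2 hαn0
  have hφx0 : 0 < saddlePhi₂ α y := saddlePhi₂_pos hy2 hα0
  have hratio : saddlePhi₂ α y ≤ K ^ 2 * saddlePhi₂ αn y := by
    rw [hK, Real.sq_sqrt (by positivity)]
    calc saddlePhi₂ α y ≤ 3 * Real.log x * Real.log y := hφx
      _ ≤ 3 / (9 / 10 * c_φ) * (c_φ * (Real.log n * Real.log y)) := by
          rw [show 3 / (9 / 10 * c_φ) * (c_φ * (Real.log n * Real.log y)) = 3 / (9 / 10) * (Real.log n * Real.log y) by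
            field_simp]
          nlinarith [mul_le_mul_of_nonneg_right hlogn hlogy0.le]
      _ ≤ 3 / (9 / 10 * c_φ) * saddlePhi₂ αn y := mul_le_mul_of_nonneg_left hφn (by positivity)
  have hsqrt : 1 / Real.sqrt (saddlePhi₂ αn y) ≤ K / Real.sqrt (saddlePhi₂ α y) := by
    rw [div_le_div_iff₀ (Real.sqrt_pos.mpr hφn0) (Real.sqrt_pos.mpr hφx0), one_mul]
    have : Real.sqrt (saddlePhi₂ α y) ≤ Real.sqrt (K ^ 2 * saddlePhi₂ αn y) := Real.sqrt_le_sqrt hratio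
    rwa [Real.sqrt_mul' _ hφn0.le, Real.sqrt_sq hK0.le] at this
  -- (f) `R_n^{e} n^{α} ≤ R^{e} x^{α}`, `e = −1/2 + 3/2(1−α) ≤ 0`, using `R_n = R (n/x)` and `(n/x)^{e+α} ≤ 1`
  set e : ℝ := -(1 / 2 : ℝ) + 3 / 2 * (1 - α) with he
  have hnx1 : (n : ℝ) / x ≤ 1 := by rw [div_le_one hx0]; exact hnx
  have hnx0 : 0 < (n : ℝ) / x := by positivity
  have hpow : Rn ^ e * (n : ℝ) ^ α ≤ R ^ e * x ^ α := by
    have h1 : Rn = R * ((n : ℝ) / x) := by rw [hRn]; ring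
    rw [h1, Real.mul_rpow (by linarith) hnx0.le]
    have h2 : (n : ℝ) ^ α = x ^ α * ((n : ℝ) / x) ^ α := by
      rw [Real.div_rpow hn0.le hx0.le]; field_simp
    rw [h2]
    have h3 : ((n : ℝ) / x) ^ e * ((n : ℝ) / x) ^ α ≤ 1 := by
      rw [← Real.rpow_add hnx0]
      exact Real.rpow_le_one hnx0.le hnx1 (by rw [he]; nlinarith)
    calc R ^ e * ((n : ℝ) / x) ^ e * (x ^ α * ((n : ℝ) / x) ^ α)
        = R ^ e * x ^ α * (((n : ℝ) / x) ^ e * ((n : ℝ) / x) ^ α) := by ring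
      _ ≤ R ^ e * x ^ α * 1 := mul_le_mul_of_nonneg_left h3 (by positivity)
      _ = R ^ e * x ^ α := mul_one _
  -- ### assemble the main term
  have hmainterm : C * Real.log n ^ 3 * (y : ℝ) ^ (5 / 2 * (1 - αn)) * Rn ^ (-(1 / 2 : ℝ) + 3 / 2 * (1 - αn)) *
      ((n : ℝ) ^ αn * (smoothZeta αn y / Real.sqrt (saddlePhi₂ αn y))) ≤
      C * K * Real.log x ^ 3 * (y : ℝ) ^ (5 / 2 * (1 - α)) * R ^ e *
        (x ^ α * (smoothZeta α y / Real.sqrt (saddlePhi₂ α y))) := by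
    have hζn : 0 < smoothZeta αn y := smoothZeta_pos hαn0
    have hζ : 0 < smoothZeta α y := smoothZeta_pos hα0
    -- step 1: exponents and logs
    have s1 : C * Real.log n ^ 3 * (y : ℝ) ^ (5 / 2 * (1 - αn)) * Rn ^ (-(1 / 2 : ℝ) + 3 / 2 * (1 - αn)) ≤
        C * Real.log x ^ 3 * (y : ℝ) ^ (5 / 2 * (1 - α)) * Rn ^ e := by
      apply mul_le_mul (mul_le_mul (mul_le_mul_of_nonneg_left hlog3 hC.le) hyexp (by positivity) (by positivity))
        heexp (by positivity) (by positivity)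
    -- step 2: the saddle data `n^{αn} ζ(αn)/√φ₂(αn) ≤ K n^{α} ζ(α)/√φ₂(α)`
    have s2 : (n : ℝ) ^ αn * (smoothZeta αn y / Real.sqrt (saddlePhi₂ αn y)) ≤
        K * ((n : ℝ) ^ α * smoothZeta α y / Real.sqrt (saddlePhi₂ α y)) := by
      calc (n : ℝ) ^ αn * (smoothZeta αn y / Real.sqrt (saddlePhi₂ αn y))
          = ((n : ℝ) ^ αn * smoothZeta αn y) * (1 / Real.sqrt (saddlePhi₂ αn y)) := by ring
        _ ≤ ((n : ℝ) ^ α * smoothZeta α y) * (K / Real.sqrt (saddlePhi₂ α y)) :=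
            mul_le_mul hminim hsqrt (by positivity) (by positivity)
        _ = _ := by ring
    calc _ ≤ (C * Real.log x ^ 3 * (y : ℝ) ^ (5 / 2 * (1 - α)) * Rn ^ e) *
          (K * ((n : ℝ) ^ α * smoothZeta α y / Real.sqrt (saddlePhi₂ α y))) :=
          mul_le_mul s1 s2 (by positivity) (by positivity)
      _ = C * K * Real.log x ^ 3 * (y : ℝ) ^ (5 / 2 * (1 - α)) * (Rn ^ e * (n : ℝ) ^ α) *
            (smoothZeta α y / Real.sqrt (saddlePhi₂ α y)) := by ring
      _ ≤ C * K * Real.log x ^ 3 * (y : ℝ) ^ (5 / 2 * (1 - α)) * (R ^ e * x ^ α) *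
            (smoothZeta α y / Real.sqrt (saddlePhi₂ α y)) := by
          apply mul_le_mul_of_nonneg_right _ (by positivity)
          exact mul_le_mul_of_nonneg_left hpow (by positivity)
      _ = _ := by ring
  -- ### the junk term
  have hjunk : 41 * (1 + Real.log n) ^ 2 * (y : ℝ) ^ 2 * (n : ℝ) ^ (9 / 10 : ℝ) ≤
      41 * (1 + Real.log x) ^ 2 * (y : ℝ) ^ 2 * x ^ (9 / 10 : ℝ) := by
    apply mul_le_mul _ (Real.rpow_le_rpow hn0.le hnx (by norm_num)) (by positivity) (by positivity)
    apply mul_le_mul_of_nonneg_right _ (by positivity)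
    apply mul_le_mul_of_nonneg_left _ (by norm_num)
    exact pow_le_pow_left₀ (by linarith) (by linarith) 2
  rw [he] at hmainterm
  linarith [hmainterm, hjunk]

/-! ### The smooth-weighted sum on a minor arc -/

set_option maxHeartbeats 1600000 in
/-- **Minor arcs for the smooth-weighted sums.** See the module docstring.
[cite: Harper2016, Theorem 1 and §5] -/
theorem norm_smoothWeightSum_le_of_minor :
    ∃ C x₀ : ℝ, 0 < C ∧ ∀ (x : ℝ) (y : ℕ), x₀ ≤ x → Real.log x ^ 8 ≤ y →
      Real.log y ≤ 1 / 2 * Real.log x ^ (1 / 6 : ℝ) → (y : ℝ) ^ 80 ≤ x → ∀ X : ℝ, x / 2 ≤ X → X ≤ x →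
      ∀ (R : ℝ), 1 ≤ R → R ≤ x ^ (1 / 10 : ℝ) →
      ∀ θ : ℝ, (∀ q : ℕ, 1 ≤ q → (q : ℝ) ≤ R → ∀ a : ℤ, R / x < |θ - a / q|) →
        ‖smoothWeightSum X y θ‖ ≤
          C * Real.log x ^ 3 * (y : ℝ) ^ (5 / 2 * (1 - saddlePoint x y)) *
            R ^ (-(1 / 2 : ℝ) + 3 / 2 * (1 - saddlePoint x y)) *
            (x ^ saddlePoint x y * (smoothZeta (saddlePoint x y) y / Real.sqrt (saddlePhi₂ (saddlePoint x y) y))) +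
          164 * (1 + Real.log x) ^ 2 * (y : ℝ) ^ 2 * x ^ (9 / 10 : ℝ) + 64 * x / R ^ 3 + 1 := by
  classical
  obtain ⟨C, x₀, hC, hsharp⟩ := norm_sharpSum_le_of_minor
  refine ⟨4 * C, max x₀ 4, by positivity, fun x y hx hy8 hylog hy80 X hXlo hXhi R hR1 hRx θ hminor => ?_⟩
  have hx₀ : x₀ ≤ x := le_trans (le_max_left _ _) hx
  have hx4 : 4 ≤ x := le_trans (le_max_right _ _) hx
  have hx0 : 0 < x := by linarith
  have hX1 : 1 ≤ X := by linarith
  have hX0 : 0 < X := by linarith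
  set N : ℕ := ⌊X⌋₊ with hN
  have hNX : (N : ℝ) ≤ X := Nat.floor_le hX0.le
  have hXN : X < N + 1 := Nat.lt_floor_add_one X
  -- the bound `A` for the sharp sums at the scales `x/R ≤ n ≤ x`
  set A : ℝ := C * Real.log x ^ 3 * (y : ℝ) ^ (5 / 2 * (1 - saddlePoint x y)) *
      R ^ (-(1 / 2 : ℝ) + 3 / 2 * (1 - saddlePoint x y)) *
      (x ^ saddlePoint x y * (smoothZeta (saddlePoint x y) y / Real.sqrt (saddlePhi₂ (saddlePoint x y) y))) +
    41 * (1 + Real.log x) ^ 2 * (y : ℝ) ^ 2 * x ^ (9 / 10 : ℝ) with hA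
  have hAbound : ∀ n : ℕ, x / R ≤ n → (n : ℝ) ≤ x → ‖sharpSum n y θ‖ ≤ A :=
    fun n hn1 hn2 => hsharp x y hx₀ hy8 hylog hy80 R hR1 hRx θ hminor n hn1 hn2
  have hlogx0 : 0 ≤ Real.log x := Real.log_nonneg (by linarith)
  -- `y ≥ 2` (from `(log x)^8 ≤ y`, `x ≥ 4`)
  have hy2 : 2 ≤ y := by
    have hl4 : (1 : ℝ) < Real.log x := by
      have h := Real.log_le_log (by norm_num) hx4
      have h4 : (1 : ℝ) < Real.log 4 := by
        rw [Real.lt_log_iff_exp_lt (by norm_num)]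
        have := Real.exp_one_lt_d9; linarith
      linarith
    have : (1 : ℝ) < Real.log x ^ 8 := one_lt_pow₀ hl4 (by norm_num)
    have h2 : (1 : ℝ) < y := lt_of_lt_of_le this hy8
    have h3 : 1 < y := by exact_mod_cast h2
    omega
  have hx1 : 1 < x := by linarith
  have hα0 : 0 < saddlePoint x y := saddlePoint_pos hx1 hy2
  have hP0 : 0 ≤ x ^ saddlePoint x y * (smoothZeta (saddlePoint x y) y / Real.sqrt (saddlePhi₂ (saddlePoint x y) y)) := by
    have := smoothZeta_pos (y := y) hα0; positivity
  have hA0 : 0 ≤ A := by rw [hA]; positivity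
  -- ### Abel
  have habel := norm_smoothWeightSum_le_abel X y θ
  rw [← hN] at habel
  -- endpoint term
  have hend : |wt ((N : ℝ) / X)| * ‖sharpSum N y θ‖ ≤ 1 := by
    have hv0 : 0 ≤ (N : ℝ) / X := by positivity
    have hv1 : (N : ℝ) / X ≤ 1 := by rw [div_le_one hX0]; exact hNX
    have hwt : wt ((N : ℝ) / X) ≤ 1 / X ^ 2 := by
      unfold wt
      have h1 : 1 - (N : ℝ) / X ≤ 1 / X := by
        have e : (1 : ℝ) - N / X = (X - N) / X := by field_simp
        rw [e, div_le_div_iff_of_pos_right hX0]; linarith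
      have h2 : 0 ≤ 1 - (N : ℝ) / X := by linarith
      have h3 : (1 - (N : ℝ) / X) ^ 2 ≤ (1 / X) ^ 2 := pow_le_pow_left₀ h2 h1 2
      have h4 : ((N : ℝ) / X) ^ 2 ≤ 1 := by nlinarith
      calc ((N : ℝ) / X) ^ 2 * (1 - (N : ℝ) / X) ^ 2 ≤ 1 * (1 / X) ^ 2 := mul_le_mul h4 h3 (by positivity) zero_le_one
        _ = 1 / X ^ 2 := by ring
    rw [abs_of_nonneg (wt_nonneg _)]
    calc wt ((N : ℝ) / X) * ‖sharpSum N y θ‖ ≤ (1 / X ^ 2) * N := mul_le_mul hwt (norm_sharpSum_le N y θ) (norm_nonneg _) (by positivity)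
      _ ≤ (1 / X ^ 2) * X := mul_le_mul_of_nonneg_left hNX (by positivity)
      _ = 1 / X := by field_simp
      _ ≤ 1 := by rw [div_le_one hX0]; exact hX1
  -- variation of the weights
  have hΔ : ∀ n ∈ Ico 1 N, |wt (((n + 1 : ℕ) : ℝ) / X) - wt ((n : ℝ) / X)| ≤ 2 * ((n : ℝ) + 1) / X ^ 2 := by
    intro n hn
    obtain ⟨hn1, hnN⟩ := Finset.mem_Ico.mp hn
    have hu1 : ((n + 1 : ℕ) : ℝ) / X ≤ 1 := by
      rw [div_le_one hX0]; exact le_trans (by exact_mod_cast hnN) hNX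
    have hv0 : 0 ≤ (n : ℝ) / X := by positivity
    have hvu : (n : ℝ) / X ≤ ((n + 1 : ℕ) : ℝ) / X := by
      apply div_le_div_of_nonneg_right _ hX0.le; push_cast; linarith
    refine (abs_wt_sub_le hu1 hv0 hvu).trans (le_of_eq ?_)
    push_cast; field_simp; ring
  -- ### split the sum at `M = ⌈x/R⌉`
  set M : ℕ := ⌈x / R⌉₊ with hM
  have hxR1 : 1 ≤ x / R := by
    rw [le_div_iff₀ (by linarith), one_mul]
    calc R ≤ x ^ (1 / 10 : ℝ) := hRx
      _ ≤ x ^ (1 : ℝ) := Real.rpow_le_rpow_of_exponent_le hx1.le (by norm_num)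
      _ = x := Real.rpow_one x
  have hMle : (M : ℝ) ≤ 2 * (x / R) := by
    have := Nat.ceil_lt_add_one (by positivity : 0 ≤ x / R); rw [← hM] at this; linarith
  have hMge : x / R ≤ M := Nat.le_ceil _
  have hsmall : ∑ n ∈ (Ico 1 N).filter (fun n => n < M), |wt (((n + 1 : ℕ) : ℝ) / X) - wt ((n : ℝ) / X)| * ‖sharpSum n y θ‖ ≤
      64 * x / R ^ 3 := by
    have hterm : ∀ n ∈ (Ico 1 N).filter (fun n => n < M),
        |wt (((n + 1 : ℕ) : ℝ) / X) - wt ((n : ℝ) / X)| * ‖sharpSum n y θ‖ ≤ 2 * (M : ℝ) ^ 2 / X ^ 2 := by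
      intro n hn
      obtain ⟨hn, hnM⟩ := Finset.mem_filter.mp hn
      have hnM' : (n : ℝ) + 1 ≤ M := by exact_mod_cast hnM
      have h1 := hΔ n hn
      have h2 := norm_sharpSum_le n y θ
      have hn0 : (0 : ℝ) ≤ n := Nat.cast_nonneg n
      calc _ ≤ (2 * ((n : ℝ) + 1) / X ^ 2) * n := mul_le_mul h1 h2 (norm_nonneg _) (by positivity)
        _ ≤ 2 * (M : ℝ) ^ 2 / X ^ 2 := by
            rw [div_mul_eq_mul_div, div_le_div_iff_of_pos_right (by positivity)]
            nlinarith
    calc _ ≤ ∑ n ∈ (Ico 1 N).filter (fun n => n < M), 2 * (M : ℝ) ^ 2 / X ^ 2 := Finset.sum_le_sum hterm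
      _ = (((Ico 1 N).filter (fun n => n < M)).card : ℝ) * (2 * (M : ℝ) ^ 2 / X ^ 2) := by
          rw [Finset.sum_const, nsmul_eq_mul]
      _ ≤ (M : ℝ) * (2 * (M : ℝ) ^ 2 / X ^ 2) := by
          apply mul_le_mul_of_nonneg_right _ (by positivity)
          have : (Ico 1 N).filter (fun n => n < M) ⊆ Finset.range M := by
            intro n hn; exact Finset.mem_range.mpr (Finset.mem_filter.mp hn).2
          exact_mod_cast (Finset.card_le_card this).trans (Finset.card_range M).le
      _ = 2 * (M : ℝ) ^ 3 / X ^ 2 := by ring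
      _ ≤ 2 * (2 * (x / R)) ^ 3 / (x / 2) ^ 2 := by
          apply div_le_div₀ (by positivity) _ (by positivity) (pow_le_pow_left₀ (by positivity) hXlo 2)
          exact mul_le_mul_of_nonneg_left (pow_le_pow_left₀ (Nat.cast_nonneg M) hMle 3) (by norm_num)
      _ = 64 * x / R ^ 3 := by field_simp; norm_num
  have hlarge : ∑ n ∈ (Ico 1 N).filter (fun n => ¬ n < M), |wt (((n + 1 : ℕ) : ℝ) / X) - wt ((n : ℝ) / X)| * ‖sharpSum n y θ‖ ≤
      4 * A := by
    have hterm : ∀ n ∈ (Ico 1 N).filter (fun n => ¬ n < M),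
        |wt (((n + 1 : ℕ) : ℝ) / X) - wt ((n : ℝ) / X)| * ‖sharpSum n y θ‖ ≤ (2 * ((n : ℝ) + 1) / X ^ 2) * A := by
      intro n hn
      obtain ⟨hn, hnM⟩ := Finset.mem_filter.mp hn
      push Not at hnM
      obtain ⟨hn1, hnN⟩ := Finset.mem_Ico.mp hn
      have hnlo : x / R ≤ n := le_trans hMge (by exact_mod_cast hnM)
      have hnhi : (n : ℝ) ≤ x := le_trans (le_trans (by exact_mod_cast hnN.le) hNX) hXhi
      exact mul_le_mul (hΔ n hn) (hAbound n hnlo hnhi) (norm_nonneg _) (by positivity)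
    calc _ ≤ ∑ n ∈ (Ico 1 N).filter (fun n => ¬ n < M), (2 * ((n : ℝ) + 1) / X ^ 2) * A := Finset.sum_le_sum hterm
      _ ≤ ∑ n ∈ Ico 1 N, (2 * ((n : ℝ) + 1) / X ^ 2) * A :=
          Finset.sum_le_sum_of_subset_of_nonneg (Finset.filter_subset _ _) fun n _ _ => by positivity
      _ = (2 * A / X ^ 2) * ∑ n ∈ Ico 1 N, ((n : ℝ) + 1) := by
          rw [Finset.mul_sum]; refine Finset.sum_congr rfl fun n _ => by ring
      _ ≤ (2 * A / X ^ 2) * ((N : ℝ) * (N + 1)) := by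
          apply mul_le_mul_of_nonneg_left _ (by positivity)
          -- `∑_{n=1}^{N−1} (n+1) ≤ N (N+1)`: each of the `N − 1` terms is `≤ N + 1 ≤ …`; crude: `(n+1) ≤ N` termwise? use `≤ N+1`
          calc ∑ n ∈ Ico 1 N, ((n : ℝ) + 1) ≤ ∑ n ∈ Ico 1 N, ((N : ℝ) + 1) := by
                refine Finset.sum_le_sum fun n hn => ?_
                have := (Finset.mem_Ico.mp hn).2
                have : (n : ℝ) + 1 ≤ N := by exact_mod_cast this
                linarith
            _ = ((N - 1 : ℕ) : ℝ) * ((N : ℝ) + 1) := by rw [Finset.sum_const, Nat.card_Ico, nsmul_eq_mul]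
            _ ≤ (N : ℝ) * (N + 1) := by
                apply mul_le_mul_of_nonneg_right _ (by positivity)
                exact_mod_cast Nat.sub_le N 1
      _ ≤ (2 * A / X ^ 2) * (X * (X + 1)) := by
          apply mul_le_mul_of_nonneg_left _ (by positivity)
          exact mul_le_mul hNX (by linarith) (by positivity) hX0.le
      _ = 2 * A * ((X + 1) / X) := by field_simp
      _ ≤ 2 * A * 2 := by
          apply mul_le_mul_of_nonneg_left _ (by positivity)
          rw [div_le_iff₀ hX0]; linarith
      _ = 4 * A := by ring
  -- ### assemble
  have hsplit := Finset.sum_filter_add_sum_filter_not (Ico 1 N) (fun n => n < M)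
    (fun n => |wt (((n + 1 : ℕ) : ℝ) / X) - wt ((n : ℝ) / X)| * ‖sharpSum n y θ‖)
  have htot : ∑ n ∈ Ico 1 N, |wt (((n + 1 : ℕ) : ℝ) / X) - wt ((n : ℝ) / X)| * ‖sharpSum n y θ‖ ≤ 64 * x / R ^ 3 + 4 * A := by
    rw [← hsplit]; exact add_le_add hsmall hlarge
  rw [hA] at htot
  linarith [habel, hend, htot]

end Endgame

end Literature.NumberTheory.Sieve

end
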